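import Summits.CriticalPhenomena.Ising3DConformalLimit.Theses.LocalisationClock
import HarnessLib

/-!
# Crux-ideate sketch (ideator k=2, round 1) — `LocalisationClock.ImryMaWindowNoise` (stmt-CriticalPhenomena-15883)

First lemmas of two idea cards, typed over the crux's VERBATIM `let` block (`w, tilt, m, Af, r, P, σ2`),
plus the kernel-checked recomposition for card 1.

* Card `kurtosis-ratchet`: `Sig.KurtosisRatchet` (KR: instantaneous, division-free form of
  "the posterior-mean kurtosis `k = P[m⁴]/P[m²]²` is non-increasing while `P[m²] ≤ b₀σ²`":
  `3·P[m² r]·P[m²] ≤ P[m⁴]·P[r]`), `Sig.EarlyDeficit` (ED: cumulative anti-correlation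
  `D = 3P[m²]² − P[m⁴] ≥ 3c·P[m²]²` on a window below any level `b₀`), `Sig.RateNonneg` (trivial support),
  `Sig.KurtosisRatchetFerro` (the universal finite-ferromagnet form of KR, the card's first lemma / cheapest
  falsifier target), and `ImryMaWindowNoise_of_ratchet : KR → ED → RateNonneg → crux` (no `sorry`).
* Card `curie-weiss-fibre`: `Sig.NoiseMeanExchange` (replacing the sample mean of the channel noise by an
  independent `N(0,1/n)` leaves every planted expectation unchanged — licenses conditioning on the zero-mean
  part of the observation), `Sig.RateFlatDomination` (F3, provable now: `P[r]·|Λ_L| ≤ C·P[v²]` on the window,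
  `v` = posterior variance of the block spin) and `Sig.FibreAnticoncentration` (F1: the crux with the rate
  replaced by its flat part `v²`).
-/

noncomputable section

namespace Summit.CriticalPhenomena.Ising3DConformalLimit.Cruxes.ImryMaWindowNoise.Ideate2

open scoped BigOperators Topology Manifold Classical MeasureTheory ProbabilityTheory Matrix InnerProductSpace ComplexConjugate ContinuousMap
open Filter Set Function TopologicalSpace MeasureTheory

/-- Real-arithmetic core of the ratchet recomposition: from the ratchet inequality `3·X·Pm ≤ P4·Pr`,
the deficit `3c·Pm² ≤ 3Pm² − P4`, `Pr ≥ 0` and `Pm > 0` conclude `X − Pr·Pm ≤ −c·Pr·Pm`. [folklore] -/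
theorem ratchet_core {X Pr Pm P4 c : ℝ} (hK : 3 * (X * Pm) ≤ P4 * Pr) (hE : 3 * c * Pm ^ 2 ≤ 3 * Pm ^ 2 - P4)
    (hr : 0 ≤ Pr) (hPm : 0 < Pm) : X - Pr * Pm ≤ -(c * (Pr * Pm)) := by
  have h1 : P4 * Pr ≤ (3 * Pm ^ 2 - 3 * c * Pm ^ 2) * Pr :=
    mul_le_mul_of_nonneg_right (by linarith) hr
  have h2 : 3 * (X * Pm) ≤ (3 * Pm ^ 2 - 3 * c * Pm ^ 2) * Pr := hK.trans h1
  have h3 : Pm * (3 * X - 3 * (1 - c) * (Pm * Pr)) ≤ 0 := by nlinarith [h2]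
  have h4 : 3 * X - 3 * (1 - c) * (Pm * Pr) ≤ 0 := by
    by_contra h
    push_neg at h
    nlinarith [mul_pos hPm h]
  nlinarith [h4]

namespace Sig

/-- KR — KURTOSIS RATCHET (instantaneous, division-free form). With `k(s) := P_s[m⁴]/P_s[m²]²` the kurtosis of
the posterior block polarisation and the clock calculus `d/ds P_s[m⁴] = 6P_s[m² r]`, `d/ds P_s[m²] = P_s[r]`,
`k` is non-increasing at `s` iff `3·P[m² r]·P[m²] ≤ P[m⁴]·P[r]`, i.e. iff `R(s) ≥ (3 − k(s))/3`. Claimed while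
the clock level `P_s[m²]/σ_L²` is below a universal `b₀ < 1`. [folklore] -/
def KurtosisRatchet : Prop :=
  let βc : ℝ := Literature.Probability.LatticeModels.criticalBeta 3; let w : (L : ℕ) → (↥(Literature.Probability.LatticeModels.box 3 L) → ℤˣ) → ℝ := fun L τ => Literature.Probability.LatticeModels.plusExpect 3 βc 0 (fun σ => if (∀ x : ↥(Literature.Probability.LatticeModels.box 3 L), σ x = τ x) then 1 else 0); let tilt : (L : ℕ) → (↥(Literature.Probability.LatticeModels.box 3 L) → ℝ) → ((↥(Literature.Probability.LatticeModels.box 3 L) → ℤˣ) → ℝ) → ℝ := fun L y g => (∑ τ, w L τ * g τ * Real.exp (∑ x, y x * ((τ x : ℤ) : ℝ))) / (∑ τ, w L τ * Real.exp (∑ x, y x * ((τ x : ℤ) : ℝ))); let m : (L : ℕ) → (↥(Literature.Probability.LatticeModels.box 3 L) → ℝ) → ℝ := fun L y => tilt L y (fun τ => ∑ x, ((τ x : ℤ) : ℝ)); let Af : (L : ℕ) → (↥(Literature.Probability.LatticeModels.box 3 L) → ℝ) → ↥(Literature.Probability.LatticeModels.box 3 L) → ℝ := fun L y x => tilt L y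 (fun τ => ((τ x : ℤ) : ℝ) * ∑ x', ((τ x' : ℤ) : ℝ)) - tilt L y (fun τ => ((τ x : ℤ) : ℝ)) * m L y; let r : (L : ℕ) → (↥(Literature.Probability.LatticeModels.box 3 L) → ℝ) → ℝ := fun L y => ∑ x, Af L y x ^ 2; let P : (L : ℕ) → ℝ → ((↥(Literature.Probability.LatticeModels.box 3 L) → ℝ) → ℝ) → ℝ := fun L s Φ => ∑ τ, w L τ * ∫ z, Φ (fun x => s * ((τ x : ℤ) : ℝ) + Real.sqrt s * z x) ∂(Measure.pi fun _ : ↥(Literature.Probability.LatticeModels.box 3 L) => ProbabilityTheory.gaussianReal 0 1); let σ2 : ℕ → ℝ := fun L => Literature.Probability.LatticeModels.plusExpect 3 βc 0 (fun σ => (∑ x ∈ Literature.Probability.LatticeModels.box 3 L, Literature.Probability.LatticeModels.spinAt x σ) ^ 2); ∃ b₀ : ℝ, 0 < b₀ ∧ b₀ < 1 ∧ ∃ L₀ : ℕ, ∀ L ≥ L₀, ∀ s : ℝ, 0 ≤ s → P L s (fun y => m L y ^ 2) ≤ b₀ * σ2 L → 3 * (P L s (fun y => r L y * m L y ^ 2)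 * P L s (fun y => m L y ^ 2)) ≤ P L s (fun y => m L y ^ 4) * P L s (r L)

/-- ED — EARLY (cumulative) DEFICIT: below every level `b₀` there is a window on which the accumulated
anti-correlation `D_s = 3P_s[m²]² − P_s[m⁴] = −6∫₀ˢ Cov` is an order-one fraction of `3P_s[m²]²`. Fed by the
perturbative edge of the flow: `D_s/P_s[m²]² = 4s|U₄(G𝟙,𝟙,G𝟙,G𝟙)|/‖G𝟙‖⁴(1+o(1))`, so ED ⟸ UniformSmallSNR ∧
`liminf ĝ_L > 0` (Target-equivalent input, census §1a). [folklore] -/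
def EarlyDeficit : Prop :=
  let βc : ℝ := Literature.Probability.LatticeModels.criticalBeta 3; let w : (L : ℕ) → (↥(Literature.Probability.LatticeModels.box 3 L) → ℤˣ) → ℝ := fun L τ => Literature.Probability.LatticeModels.plusExpect 3 βc 0 (fun σ => if (∀ x : ↥(Literature.Probability.LatticeModels.box 3 L), σ x = τ x) then 1 else 0); let tilt : (L : ℕ) → (↥(Literature.Probability.LatticeModels.box 3 L) → ℝ) → ((↥(Literature.Probability.LatticeModels.box 3 L) → ℤˣ) → ℝ) → ℝ := fun L y g => (∑ τ, w L τ * g τ * Real.exp (∑ x, y x * ((τ x : ℤ) : ℝ))) / (∑ τ, w L τ * Real.exp (∑ x, y x * ((τ x : ℤ) : ℝ))); let m : (L : ℕ) → (↥(Literature.Probability.LatticeModels.box 3 L) → ℝ) → ℝ := fun L y => tilt L y (fun τ => ∑ x, ((τ x : ℤ) : ℝ)); let Af : (L : ℕ) → (↥(Literature.Probability.LatticeModels.box 3 L) → ℝ) → ↥(Literature.Probability.LatticeModels.box 3 L) → ℝ := fun L y x => tilt L y (fun τ => ((τ x : ℤ) : ℝ) * ∑ x', ((τ x' : ℤ) :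 ℝ)) - tilt L y (fun τ => ((τ x : ℤ) : ℝ)) * m L y; let r : (L : ℕ) → (↥(Literature.Probability.LatticeModels.box 3 L) → ℝ) → ℝ := fun L y => ∑ x, Af L y x ^ 2; let P : (L : ℕ) → ℝ → ((↥(Literature.Probability.LatticeModels.box 3 L) → ℝ) → ℝ) → ℝ := fun L s Φ => ∑ τ, w L τ * ∫ z, Φ (fun x => s * ((τ x : ℤ) : ℝ) + Real.sqrt s * z x) ∂(Measure.pi fun _ : ↥(Literature.Probability.LatticeModels.box 3 L) => ProbabilityTheory.gaussianReal 0 1); let σ2 : ℕ → ℝ := fun L => Literature.Probability.LatticeModels.plusExpect 3 βc 0 (fun σ => (∑ x ∈ Literature.Probability.LatticeModels.box 3 L, Literature.Probability.LatticeModels.spinAt x σ) ^ 2); ∀ b₀ : ℝ, 0 < b₀ → b₀ < 1 → ∃ a b c : ℝ, 0 < a ∧ a < b ∧ b ≤ b₀ ∧ 0 < c ∧ ∃ L₀ : ℕ, ∀ L ≥ L₀, 0 < σ2 L ∧ ∀ s : ℝ, 0 ≤ s → a * σ2 L ≤ P L s (fun y => m L y ^ 2) → P L s (fun y => m L y ^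 2) ≤ b * σ2 L → 3 * c * P L s (fun y => m L y ^ 2) ^ 2 ≤ 3 * P L s (fun y => m L y ^ 2) ^ 2 - P L s (fun y => m L y ^ 4)

/-- Trivial support: the planted clock rate is non-negative (`r` is a sum of squares, `w_L ≥ 0`). [folklore] -/
def RateNonneg : Prop :=
  let βc : ℝ := Literature.Probability.LatticeModels.criticalBeta 3; let w : (L : ℕ) → (↥(Literature.Probability.LatticeModels.box 3 L) → ℤˣ) → ℝ := fun L τ => Literature.Probability.LatticeModels.plusExpect 3 βc 0 (fun σ => if (∀ x : ↥(Literature.Probability.LatticeModels.box 3 L), σ x = τ x) then 1 else 0); let tilt : (L : ℕ) → (↥(Literature.Probability.LatticeModels.box 3 L) → ℝ) → ((↥(Literature.Probability.LatticeModels.box 3 L) → ℤˣ) → ℝ) → ℝ := fun L y g => (∑ τ, w L τ * g τ * Real.exp (∑ x, y x * ((τ x : ℤ) : ℝ))) / (∑ τ, w L τ * Real.exp (∑ x, y x * ((τ x : ℤ) : ℝ))); let m : (L : ℕ) → (↥(Literature.Probability.LatticeModels.box 3 L) → ℝ) → ℝ := fun L y => tilt L y (fun τ => ∑ x, ((τ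 x : ℤ) : ℝ)); let Af : (L : ℕ) → (↥(Literature.Probability.LatticeModels.box 3 L) → ℝ) → ↥(Literature.Probability.LatticeModels.box 3 L) → ℝ := fun L y x => tilt L y (fun τ => ((τ x : ℤ) : ℝ) * ∑ x', ((τ x' : ℤ) : ℝ)) - tilt L y (fun τ => ((τ x : ℤ) : ℝ)) * m L y; let r : (L : ℕ) → (↥(Literature.Probability.LatticeModels.box 3 L) → ℝ) → ℝ := fun L y => ∑ x, Af L y x ^ 2; let P : (L : ℕ) → ℝ → ((↥(Literature.Probability.LatticeModels.box 3 L) → ℝ) → ℝ) → ℝ := fun L s Φ => ∑ τ, w L τ * ∫ z, Φ (fun x => s * ((τ x : ℤ) : ℝ) + Real.sqrt s * z x) ∂(Measure.pi fun _ : ↥(Literature.Probability.LatticeModels.box 3 L) => ProbabilityTheory.gaussianReal 0 1); let σ2 : ℕ → ℝ := fun L => Literature.Probability.LatticeModels.plusExpect 3 βc 0 (fun σ => (∑ x ∈ Literature.Probability.LatticeModels.box 3 L, Literature.Probability.LatticeModels.spinAt x σ) ^ 2); ∀ (L : ℕ) (s : ℝ), 0 ≤ s → 0 ≤ P L s (r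 L)

/-- KR for EVERY finite zero-field pair ferromagnet observed through the Gaussian channel on all sites
(the card's first lemma and cheapest-falsifier target; same functional family as `LocalisationGHS`). [folklore] -/
def KurtosisRatchetFerro : Prop :=
  ∃ b₀ : ℝ, 0 < b₀ ∧ b₀ < 1 ∧ ∀ (n : ℕ) (c : Fin n → Fin n → ℝ) (s : ℝ), (∀ a b, 0 ≤ c a b) → 0 ≤ s → let tilt : (Fin n → ℝ) → (Literature.Probability.LatticeModels.SpinConfig (Fin n) → ℝ) → ℝ := fun y g => Literature.Probability.LatticeModels.PairIsing.gibbsAvg c (fun σ => g σ * Real.exp (∑ a, y a * Literature.Probability.LatticeModels.spinAt a σ)) / Literature.Probability.LatticeModels.PairIsing.gibbsAvg c (fun σ => Real.exp (∑ a, y a * Literature.Probability.LatticeModels.spinAt a σ)); let blk : Literature.Probability.LatticeModels.SpinConfig (Fin n) → ℝ := fun σ => ∑ a, Literature.Probability.LatticeModels.spinAt a σ; let m : (Fin n → ℝ) → ℝ := fun y => tilt y blk; let Af : (Fin n → ℝ) → Fin n → ℝ := fun y a => tilt y (fun σ => Literature.Probability.LatticeModels.spinAt a σ * blk σ) - tilt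 y (Literature.Probability.LatticeModels.spinAt a) * m y; let r : (Fin n → ℝ) → ℝ := fun y => ∑ a, Af y a ^ 2; let P : ((Fin n → ℝ) → ℝ) → ℝ := fun Φ => Literature.Probability.LatticeModels.PairIsing.gibbsAvg c (fun σ => ∫ z, Φ (fun a => s * Literature.Probability.LatticeModels.spinAt a σ + Real.sqrt s * z a) ∂(Measure.pi fun _ : Fin n => ProbabilityTheory.gaussianReal 0 1)); P (fun y => m y ^ 2) ≤ b₀ * Literature.Probability.LatticeModels.PairIsing.gibbsAvg c (fun σ => blk σ ^ 2) → 3 * (P (fun y => r y * m y ^ 2) * P (fun y => m y ^ 2)) ≤ P (fun y => m y ^ 4) * P r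

/-- NOISE-MEAN EXCHANGE: for bounded measurable `Φ`, replacing the sample mean of the channel noise `z` by an
independent `ξ/√n`, `ξ ~ N(0,1)`, leaves the planted expectation unchanged (`z − z̄𝟙 + (ξ/√n)𝟙` is again
standard Gaussian). This licenses conditioning on the zero-mean part `y^⊥` of the observation, under which
`(M(τ*), ȳ)` is a scalar Gaussian channel at SNR `s/n` with the Curie–Weiss-tilted prior
`ν^⊥ ∝ law(M | w·e^⟨y^⊥,τ⟩)·e^(sM²/2n)`. [folklore] -/
def NoiseMeanExchange : Prop :=
  ∀ (n : ℕ) (w : (Fin n → ℤˣ) → ℝ) (s : ℝ) (Φ : (Fin n → ℝ) → ℝ), 0 < n → 0 ≤ s → Measurable Φ → (∃ C : ℝ, ∀ y, |Φ y| ≤ C) → (∑ τ, w τ * ∫ z, Φ (fun a => s * ((τ a : ℤ) : ℝ) + Real.sqrt s * z a) ∂(Measure.pi fun _ : Fin n => ProbabilityTheory.gaussianReal 0 1)) = ∑ τ, w τ * ∫ z, (∫ ξ, Φ (fun a => s * ((τ a : ℤ) : ℝ) + Real.sqrt s * (z a - (∑ b, z b) / (n : ℝ) + ξ / Real.sqrt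 (n : ℝ))) ∂(ProbabilityTheory.gaussianReal 0 1)) ∂(Measure.pi fun _ : Fin n => ProbabilityTheory.gaussianReal 0 1)

/-- F3 — RATE FLAT DOMINATION (provable now: FKG `Cov_y(τ_x,M) ≥ 0`, DSS signed-field domination
`Cov_y(τ_x,M) ≤ (G𝟙)_x ≤ Cσ_L²/|Λ_L|` (MMS doubling), Jensen `P[v²] ≥ P[v]² = (σ_L² − P[m²])²`): on every window
the planted rate is at most a constant times its flat part, `P[r]·|Λ_L| ≤ C·P[v²]`, `v = Var_y(M)`. [folklore] -/
def RateFlatDomination : Prop :=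
  let βc : ℝ := Literature.Probability.LatticeModels.criticalBeta 3; let w : (L : ℕ) → (↥(Literature.Probability.LatticeModels.box 3 L) → ℤˣ) → ℝ := fun L τ => Literature.Probability.LatticeModels.plusExpect 3 βc 0 (fun σ => if (∀ x : ↥(Literature.Probability.LatticeModels.box 3 L), σ x = τ x) then 1 else 0); let tilt : (L : ℕ) → (↥(Literature.Probability.LatticeModels.box 3 L) → ℝ) → ((↥(Literature.Probability.LatticeModels.box 3 L) → ℤˣ) → ℝ) → ℝ := fun L y g => (∑ τ, w L τ * g τ * Real.exp (∑ x, y x * ((τ x : ℤ) : ℝ))) / (∑ τ, w L τ * Real.exp (∑ x, y x * ((τ x : ℤ) : ℝ))); let m : (L : ℕ) → (↥(Literature.Probability.LatticeModels.box 3 L) → ℝ) → ℝ := fun L y => tilt L y (fun τ => ∑ x, ((τ x : ℤ) : ℝ)); let Af : (L : ℕ) → (↥(Literature.Probability.LatticeModels.box 3 L) → ℝ) → ↥(Literature.Probability.LatticeModels.box 3 L) → ℝ := fun L y x => tilt L y (fun τ => ((τ x : ℤ) : ℝ) * ∑ x', ((τ x' : ℤ) : ℝ)) - tilt L y (fun τ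 => ((τ x : ℤ) : ℝ)) * m L y; let r : (L : ℕ) → (↥(Literature.Probability.LatticeModels.box 3 L) → ℝ) → ℝ := fun L y => ∑ x, Af L y x ^ 2; let P : (L : ℕ) → ℝ → ((↥(Literature.Probability.LatticeModels.box 3 L) → ℝ) → ℝ) → ℝ := fun L s Φ => ∑ τ, w L τ * ∫ z, Φ (fun x => s * ((τ x : ℤ) : ℝ) + Real.sqrt s * z x) ∂(Measure.pi fun _ : ↥(Literature.Probability.LatticeModels.box 3 L) => ProbabilityTheory.gaussianReal 0 1); let σ2 : ℕ → ℝ := fun L => Literature.Probability.LatticeModels.plusExpect 3 βc 0 (fun σ => (∑ x ∈ Literature.Probability.LatticeModels.box 3 L, Literature.Probability.LatticeModels.spinAt x σ) ^ 2); let v : (L : ℕ) → (↥(Literature.Probability.LatticeModels.box 3 L) → ℝ) → ℝ := fun L y => tilt L y (fun τ => (∑ x, ((τ x : ℤ) : ℝ)) ^ 2) - m L y ^ 2; ∀ a b : ℝ, 0 < a → a < b → b < 1 → ∃ C : ℝ, 0 < C ∧ ∃ L₀ : ℕ, ∀ L ≥ L₀, ∀ s : ℝ, 0 ≤ s → a *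 σ2 L ≤ P L s (fun y => m L y ^ 2) → P L s (fun y => m L y ^ 2) ≤ b * σ2 L → P L s (r L) * ((Literature.Probability.LatticeModels.box 3 L).card : ℝ) ≤ C * P L s (fun y => v L y ^ 2)

/-- F1 — FIBRE ANTI-CONCENTRATION: the crux with the rate `r` replaced by its flat part `v²`
(`v = Var_y(M)`, `r = v²/|Λ| + r^⊥`); `m` and `v` are mean and variance of the SCALAR fibre posterior. [folklore] -/
def FibreAnticoncentration : Prop :=
  let βc : ℝ := Literature.Probability.LatticeModels.criticalBeta 3; let w : (L : ℕ) → (↥(Literature.Probability.LatticeModels.box 3 L) → ℤˣ) → ℝ := fun L τ => Literature.Probability.LatticeModels.plusExpect 3 βc 0 (fun σ => if (∀ x : ↥(Literature.Probability.LatticeModels.box 3 L), σ x = τ x) then 1 else 0); let tilt : (L : ℕ) → (↥(Literature.Probability.LatticeModels.box 3 L) → ℝ) → ((↥(Literature.Probability.LatticeModels.box 3 L) → ℤˣ) → ℝ) → ℝ := fun L y g => (∑ τ, w L τ * g τ * Real.exp (∑ x, y x * ((τ x : ℤ) : ℝ))) / (∑ τ, w L τ * Real.exp (∑ x, y x * ((τ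 x : ℤ) : ℝ))); let m : (L : ℕ) → (↥(Literature.Probability.LatticeModels.box 3 L) → ℝ) → ℝ := fun L y => tilt L y (fun τ => ∑ x, ((τ x : ℤ) : ℝ)); let Af : (L : ℕ) → (↥(Literature.Probability.LatticeModels.box 3 L) → ℝ) → ↥(Literature.Probability.LatticeModels.box 3 L) → ℝ := fun L y x => tilt L y (fun τ => ((τ x : ℤ) : ℝ) * ∑ x', ((τ x' : ℤ) : ℝ)) - tilt L y (fun τ => ((τ x : ℤ) : ℝ)) * m L y; let r : (L : ℕ) → (↥(Literature.Probability.LatticeModels.box 3 L) → ℝ) → ℝ := fun L y => ∑ x, Af L y x ^ 2; let P : (L : ℕ) → ℝ → ((↥(Literature.Probability.LatticeModels.box 3 L) → ℝ) → ℝ) → ℝ := fun L s Φ => ∑ τ, w L τ * ∫ z, Φ (fun x => s * ((τ x : ℤ) : ℝ) + Real.sqrt s * z x) ∂(Measure.pi fun _ : ↥(Literature.Probability.LatticeModels.box 3 L) => ProbabilityTheory.gaussianReal 0 1); let σ2 : ℕ → ℝ := fun L => Literature.Probability.LatticeModels.plusExpect 3 βc 0 (fun σ => (∑ x ∈ Literature.Probability.LatticeModels.box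 3 L, Literature.Probability.LatticeModels.spinAt x σ) ^ 2); let v : (L : ℕ) → (↥(Literature.Probability.LatticeModels.box 3 L) → ℝ) → ℝ := fun L y => tilt L y (fun τ => (∑ x, ((τ x : ℤ) : ℝ)) ^ 2) - m L y ^ 2; ∃ a b c : ℝ, 0 < a ∧ a < b ∧ b < 1 ∧ 0 < c ∧ ∃ L₀ : ℕ, ∀ L ≥ L₀, ∀ s : ℝ, 0 ≤ s → a * σ2 L ≤ P L s (fun y => m L y ^ 2) → P L s (fun y => m L y ^ 2) ≤ b * σ2 L → P L s (fun y => v L y ^ 2 * m L y ^ 2) - P L s (fun y => v L y ^ 2) * P L s (fun y => m L y ^ 2) ≤ -(c * (P L s (fun y => v L y ^ 2) * P L s (fun y => m L y ^ 2)))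

end Sig

/-- Card 1 recomposition: KR ∧ ED ∧ RateNonneg ⇒ crux, with ED's window `[a,b]` (any `b ≤ b₀`) and ED's `c`. [folklore] -/
theorem ImryMaWindowNoise_of_ratchet :
    Sig.KurtosisRatchet → Sig.EarlyDeficit → Sig.RateNonneg → Summit.CriticalPhenomena.Ising3DConformalLimit.Theses.LocalisationClock.ImryMaWindowNoise := by
  intro hK hE hR
  obtain ⟨b₀, hb₀, hb₁, L₁, HK⟩ := hK
  obtain ⟨a, b, c, ha, hab, hbb, hc, L₂, HE⟩ := hE b₀ hb₀ hb₁
  unfold Summit.CriticalPhenomena.Ising3DConformalLimit.Theses.LocalisationClock.ImryMaWindowNoise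
  intro βc w tilt m Af r P σ2
  refine ⟨a, b, c, ha, hab, lt_of_le_of_lt hbb hb₁, hc, max L₁ L₂, ?_⟩
  intro L hL s hs h1 h2
  have hL₁ : L₁ ≤ L := le_trans (le_max_left _ _) hL
  have hL₂ : L₂ ≤ L := le_trans (le_max_right _ _) hL
  obtain ⟨hσ, HE'⟩ := HE L hL₂
  have hPm : 0 < P L s (fun y => m L y ^ 2) := lt_of_lt_of_le (mul_pos ha hσ) h1
  have hb0 : P L s (fun y => m L y ^ 2) ≤ b₀ * σ2 L := h2.trans (mul_le_mul_of_nonneg_right hbb hσ.le)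
  exact ratchet_core (HK L hL₁ s hs hb0) (HE' s hs h1 h2) (hR L s hs) hPm

end Summit.CriticalPhenomena.Ising3DConformalLimit.Cruxes.ImryMaWindowNoise.Ideate2

end
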